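import Literature.Computability.AlgebraicComplexity.BD17GaleRootCount
import Literature.Computability.AlgebraicComplexity.BD17WronskianCriterionProofs
import Mathlib.Analysis.SpecialFunctions.Pow.Real
import Mathlib.Analysis.SpecialFunctions.Log.Deriv
import Mathlib.Analysis.SpecialFunctions.ExpDeriv
import HarnessLib

/-!
# Bihan–Dickenstein 2017, Theorem 2.9 — PROVED (`BD2017_thm_2_9_holds`)

F. Bihan, A. Dickenstein, *Descartes' rule of signs for polynomial systems supported on circuits*,
Int. Math. Res. Not. IMRN 2017 (22) 6867–6893 = arXiv:1601.05826 [BihanDickenstein2017]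
(held text `paper:arxiv-1601.05826`; Thm. 2.9 = p0007:L36–44, its proof = §4.2, p0011:L19 –
p0012:L40). This file DISCHARGES the named fact `BD2017_thm_2_9` of the statement file
`BD17DescartesCircuits.lean` (cell `val-lit`, row X4-BD17):

* (2.15) `n_𝒜(C) ≤ sgnvar(s_α)` — `BD17.numPosSols_le_signVar_sAlpha`;
* (2.16) `n_𝒜(C) ≤ vol_{ℤ𝒜}(𝒜)` — `BD17.numPosSols_le_normVolume`;
* `theorem BD2017_thm_2_9_holds : BD2017_thm_2_9`, and through the reductions already in the tree
  (`BD2017_cor_3_1_of_thm_2_9'`, `BD2017_thm_3_3_of_thm_2_9`, `BD2017_cor_3_4_of_thm_2_9`) the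
  discharges `BD2017_cor_3_1_holds`, `BD2017_thm_3_3_holds`, `BD2017_cor_3_4_holds`.

THEOREMS ONLY — no new named facts. The proof FOLLOWS THE PRINTED PROOF (§4.2):

1. (tree) `n_𝒜(C)` = the number of roots of `g − 1` in `Δ_P` counted with multiplicity, for the
   Gale function `g = ∏ p_ℓ^{λ_ℓ}` of the normalized Gale dual attached to a pair
   `(ᾱ_q, ᾱ_j)` of elements of `K` (`BD17.numPosSols_eq_rootCountMult_galeFun`, files
   `BD17GaleMultiplicity.lean` = [BS08, Thm. 2.2] and `BD17GaleRootCount.lean`); finiteness of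
   `n_𝒜(C)` gives `g ≢ 1` (`BD17.galePoly_ne_zero_of_finite`).
2. (here, (2.15)) "By Rolle's theorem we get that `n_𝒜(C) ≤ N + 1` where `N` is the number of roots
   of the derivative `g'` of `g` in `Δ_P` counted with multiplicities … the logarithmic derivative
   `G` (4.5) … `ℓ ∈ K_r` if and only if `P_ℓ = γ_{ℓr} P_{ᾱ_r}` … `G(y) = ∑_r λ̄_r B_{ᾱ_r,1}/p_{ᾱ_r}(y)`
   (4.6) … by Proposition 4.3, `N ≤ sgnvar(λ̄_0 B_{ᾱ_0,1}, …)` and the signs of the `B_{ᾱ_r,1}`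
   are `−ε` before `q` and `ε` after `q` (the ordering), `B_{ᾱ_q,1} = 0`; so
   `n_𝒜(C) ≤ 1 + sgnvar(−λ̄_0, …, −λ̄_{q−1}, λ̄_{q+1}, …)`; choosing `q` as in Lemma 4.4 gives
   (2.15)" (p0011:L65 – p0012:L24): `BD17.hasDerivAt_galeFun` (`g' = g · ∑ λ_ℓ B_{ℓ,1}/p_ℓ`),
   `BD17.sum_affRel_mul_div_eq_linComb` ((4.6)), Rolle with multiplicities
   (`BD17.finite_zeros_and_rootCountMult_le_deriv_add_one`, tree), Prop. 4.3
   (`BD2017_prop_4_3_holds`, tree), the sign bookkeeping `BD17.signVar_ofFn_mul_eq` and Lemma 4.4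
   (`BD2017_lem_4_4_holds`, tree).
3. (here, (2.16)) "the number of roots of `g − 1` counted with multiplicity is at most the degree of
   the polynomial `∏_{λ̃>0} p^{λ̃} − ∏_{λ̃<0} p^{−λ̃}`, which is at most `∑_{λ̃_ℓ>0} λ̃_ℓ = vol_{ℤ𝒜}(𝒜)`"
   (p0012:L26–31): the multiplicity theorem is applied with the COPRIME relation `μ = λ̃`
   (`BD17.solMultiplicity_eq_rootMultiplicity` holds for every integer relation in `ker A` with
   `μ_b ≠ 0`), roots are counted by `Polynomial.card_roots'`, and the degree is bounded by
   `BD17.natDegree_galePoly_le`.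

Deviations from the print, all inessential: the degenerate alternatives the print dismisses in one
sentence ("As we assume that `n_𝒜(C)` is finite …") are the explicit case splits `posSolutions = ∅`,
`sgnvar(s_α) = 0` and "all coefficients `λ̄_r B_{ᾱ_r,1}` vanish", each contradicting finiteness via
`BD17.posSolutions_infinite_iff` (tree, Prop. 2.13); `k ≥ 2` is obtained from two nonzero `λ̄_r`
(their sum is `0`). Honest framing: this is the real-fewnomial bound of [BihanDickenstein2017] for
circuits; it says nothing about VP vs VNP.
-/

open Matrix Finset Polynomial

namespace Literature.Computability.AlgebraicComplexity

namespace BD17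

open Literature.Algebra.Polynomial

/-! ### Sign variation: rescaling lemmas (Pólya–Szegő V 1) -/

section SignVar

/-- Two zero-free sequences whose corresponding entries have the same signs have the same number
of sign changes. [cite: PolyaSzego1998, Part V §1 problem 1] -/
private theorem signVarAux_eq_of_forall₂ {l₁ l₂ : List ℝ}
    (h : List.Forall₂ (fun a b => 0 < a * b) l₁ l₂) : signVarAux l₁ = signVarAux l₂ := by
  induction h with
  | nil => rfl
  | @cons a b l₁ l₂ hab hrest ih =>
    cases hrest with
    | nil => rfl
    | @cons a' b' l₁' l₂' hab' hrest' =>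
      show (if a * a' < 0 then 1 else 0) + signVarAux (a' :: l₁') =
        (if b * b' < 0 then 1 else 0) + signVarAux (b' :: l₂')
      rw [ih]
      congr 1
      have hp : 0 < (a * a') * (b * b') := by
        have := mul_pos hab hab'
        nlinarith [this]
      have key : a * a' < 0 ↔ b * b' < 0 := by
        constructor
        · intro h1
          by_contra h2
          push Not at h2
          nlinarith [mul_nonneg (neg_pos.mpr h1).le h2, hp]
        · intro h1
          by_contra h2
          push Not at h2
          nlinarith [mul_nonneg h2 (neg_pos.mpr h1).le, hp]
      simp [key]

/-- Rescaling entries by positive factors is compatible with dropping the zeros.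
[cite: PolyaSzego1998, Part V §1 problem 1] -/
private theorem forall₂_filter_ne_zero {l₁ l₂ : List ℝ}
    (h : List.Forall₂ (fun a b => ∃ d : ℝ, 0 < d ∧ a = d * b) l₁ l₂) :
    List.Forall₂ (fun a b => 0 < a * b) (l₁.filter (fun a => a ≠ 0))
      (l₂.filter (fun a => a ≠ 0)) := by
  induction h with
  | nil => simp
  | @cons a b l₁ l₂ hab _ ih =>
    obtain ⟨d, hd, rfl⟩ := hab
    by_cases hb : b = 0
    · subst hb
      simpa [List.filter_cons] using ih
    · have hdb : d * b ≠ 0 := mul_ne_zero hd.ne' hb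
      rw [List.filter_cons_of_pos (by simpa using hdb), List.filter_cons_of_pos (by simpa using hb)]
      refine List.Forall₂.cons ?_ ih
      rw [mul_assoc]
      exact mul_pos hd (mul_self_pos.mpr hb)

/-- **Rescaling each entry by a positive factor does not change the number of sign changes.**
[cite: PolyaSzego1998, Part V §1 problem 1] -/
private theorem signVar_eq_of_forall₂ {l₁ l₂ : List ℝ}
    (h : List.Forall₂ (fun a b => ∃ d : ℝ, 0 < d ∧ a = d * b) l₁ l₂) : signVar l₁ = signVar l₂ := by
  unfold signVar
  exact signVarAux_eq_of_forall₂ (forall₂_filter_ne_zero h)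

/-- `List.ofFn` of pointwise related functions are `Forall₂`-related. [folklore] -/
private theorem forall₂_ofFn {k : ℕ} {R : ℝ → ℝ → Prop} {f g : Fin k → ℝ} (h : ∀ i, R (f i) (g i)) :
    List.Forall₂ R (List.ofFn f) (List.ofFn g) := by
  induction k with
  | zero => simp
  | succ k ih =>
    rw [List.ofFn_succ, List.ofFn_succ]
    exact List.Forall₂.cons (h 0) (ih fun i => h i.succ)

/-- Negating a zero-free sequence does not change its number of sign changes.
[cite: PolyaSzego1998, Part V §1 problem 1] -/
private theorem signVarAux_map_neg : ∀ l : List ℝ, signVarAux (l.map (fun x => -x)) = signVarAux l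
  | [] => rfl
  | [_] => rfl
  | a :: b :: l => by
    have ih := signVarAux_map_neg (b :: l)
    simp only [List.map_cons] at ih ⊢
    show (if -a * -b < 0 then 1 else 0) + signVarAux (-b :: l.map (fun x => -x)) =
      (if a * b < 0 then 1 else 0) + signVarAux (b :: l)
    rw [neg_mul_neg, ih]

/-- **Negating a sequence does not change its number of sign changes.**
[cite: PolyaSzego1998, Part V §1 problem 1] -/
private theorem signVar_map_neg (l : List ℝ) : signVar (l.map (fun x => -x)) = signVar l := by
  unfold signVar
  rw [List.filter_map]
  have : ((fun a : ℝ => decide (a ≠ 0)) ∘ (fun x : ℝ => -x)) = (fun a : ℝ => decide (a ≠ 0)) := by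
    funext a
    simp
  rw [this, signVarAux_map_neg]

/-- A zero entry may be dropped. [cite: PolyaSzego1998, Part V §1 problem 1] -/
private theorem signVar_append_zero_cons (l₁ l₂ : List ℝ) :
    signVar (l₁ ++ 0 :: l₂) = signVar (l₁ ++ l₂) := by
  unfold signVar
  simp [List.filter_append]

/-- **The sign bookkeeping of the proof of Thm. 2.9** (p0012:L13–22): if `β_q = 0`, `ε β_r < 0` for
`r < q` and `ε β_r > 0` for `r > q` (`ε = ±1`), then
`sgnvar(a_0 β_0, …, a_{k−1} β_{k−1}) = sgnvar(−a_0, …, −a_{q−1}, a_{q+1}, …, a_{k−1})`.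
[cite: BihanDickenstein2017, §4.2 (proof of Thm. 2.9)] -/
theorem signVar_ofFn_mul_eq {k : ℕ} (a β : Fin k → ℝ) (q : Fin k) {ε : ℝ} (hε : ε = 1 ∨ ε = -1)
    (hq : β q = 0) (hlt : ∀ r, r < q → ε * β r < 0) (hgt : ∀ r, q < r → 0 < ε * β r) :
    signVar (List.ofFn fun r => a r * β r) =
      signVar (((List.ofFn a).take q).map (fun c => -c) ++ (List.ofFn a).drop (q + 1)) := by
  cases k with
  | zero => exact q.elim0
  | succ t =>
    -- (1) replace `β` by `ε β` (global sign `ε`)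
    have h1 : signVar (List.ofFn fun r => a r * β r) =
        signVar (List.ofFn fun r => (ε * β r) * a r) := by
      rcases hε with rfl | rfl
      · exact congrArg _ (congrArg _ (funext fun r => by ring))
      · rw [show (List.ofFn fun r => a r * β r) =
            (List.ofFn fun r => (-1 * β r) * a r).map (fun x => -x) by
          rw [List.map_ofFn]
          exact congrArg _ (funext fun r => by simp only [Function.comp_apply]; ring)]
        exact signVar_map_neg _
    rw [h1]
    -- (2) the sequence of Pólya–Szegő solution 90, extended by `0` at `q`
    set c : Fin t → ℝ := fun j => (if Fin.castSucc j < q then (-1 : ℝ) else 1) * a (q.succAbove j)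
      with hc
    have hJ : StrictMono q.succAbove := Fin.strictMono_succAbove q
    have hext : ∀ r, ∃ d : ℝ, 0 < d ∧
        (ε * β r) * a r = d * Function.extend q.succAbove c (fun _ => (0 : ℝ)) r := by
      intro r
      by_cases hr : r = q
      · subst hr
        refine ⟨1, one_pos, ?_⟩
        rw [Function.extend_apply' _ _ _ (fun ⟨j, hj⟩ => Fin.succAbove_ne _ _ hj), hq]
        ring
      · obtain ⟨j, rfl⟩ := Fin.exists_succAbove_eq hr
        rw [hJ.injective.extend_apply]
        simp only [hc]
        by_cases hjq : q.succAbove j < q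
        · have hlt' : Fin.castSucc j < q := (Fin.succAbove_lt_iff_castSucc_lt _ _).mp hjq
          refine ⟨-(ε * β (q.succAbove j)), by linarith [hlt _ hjq], ?_⟩
          rw [if_pos hlt']
          ring
        · have hgt' : q < q.succAbove j :=
            lt_of_le_of_ne (not_lt.mp hjq) (Ne.symm (Fin.succAbove_ne _ _))
          have hnlt : ¬ Fin.castSucc j < q := fun h =>
            hjq ((Fin.succAbove_lt_iff_castSucc_lt _ _).mpr h)
          refine ⟨ε * β (q.succAbove j), hgt _ hgt', ?_⟩
          rw [if_neg hnlt]
          ring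
    rw [signVar_eq_of_forall₂ (forall₂_ofFn hext), signVar_ofFn_extend _ hJ c, hc,
      ofFn_transform_eq_negTake_append_drop a q]

end SignVar

/-! ### The derivative of the Gale function `g = ∏ p_ℓ^{μ_ℓ}` and the regrouping (4.6) -/

section Deriv

variable {n : ℕ}

/-- `p_ℓ' = B_{ℓ,1}`. [cite: BihanDickenstein2017, §4.1 eq. (4.1)] -/
theorem hasDerivAt_galeLin (B : Matrix (Fin (n + 2)) (Fin 2) ℝ) (ℓ : Fin (n + 2)) (y : ℝ) :
    HasDerivAt (galeLin B ℓ) (B ℓ 1) y := by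
  have h := ((hasDerivAt_id y).const_mul (B ℓ 1)).const_add (B ℓ 0)
  rw [mul_one] at h
  exact h

/-- **`g' = g · ∑_ℓ μ_ℓ B_{ℓ,1}/p_ℓ` on `Δ_P`** (the logarithmic derivative (4.5), p0011:L73–76:
"`G(y) = Σ λ_ℓ B_{ℓ,1}/p_ℓ(y)` … the derivative of `log|g|`").
[cite: BihanDickenstein2017, §4.2 eq. (4.5)] -/
theorem hasDerivAt_galeFun (B : Matrix (Fin (n + 2)) (Fin 2) ℝ) (μ : Fin (n + 2) → ℤ) {y : ℝ}
    (hy : y ∈ galeInterval B) :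
    HasDerivAt (galeFun B μ) (galeFun B μ y * ∑ ℓ, (μ ℓ : ℝ) * (B ℓ 1 / galeLin B ℓ y)) y := by
  have hLd : HasDerivAt (fun y => ∑ ℓ, (μ ℓ : ℝ) * Real.log (galeLin B ℓ y))
      (∑ ℓ, (μ ℓ : ℝ) * (B ℓ 1 / galeLin B ℓ y)) y := by
    refine HasDerivAt.fun_sum (u := Finset.univ)
      (A := fun ℓ y => (μ ℓ : ℝ) * Real.log (galeLin B ℓ y))
      (A' := fun ℓ => (μ ℓ : ℝ) * (B ℓ 1 / galeLin B ℓ y)) fun ℓ _ => ?_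
    have h1 := ((Real.hasDerivAt_log (hy ℓ).ne').comp y (hasDerivAt_galeLin B ℓ y)).const_mul
      (μ ℓ : ℝ)
    show HasDerivAt (fun y => (μ ℓ : ℝ) * Real.log (galeLin B ℓ y))
      ((μ ℓ : ℝ) * (B ℓ 1 / galeLin B ℓ y)) y
    rw [div_eq_inv_mul]
    exact h1
  have hexp := hLd.exp
  have heq : Set.EqOn (fun y => Real.exp (∑ ℓ, (μ ℓ : ℝ) * Real.log (galeLin B ℓ y)))
      (galeFun B μ) (galeInterval B) := by
    intro y' hy'
    simp only [galeFun, Real.exp_sum]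
    refine Finset.prod_congr rfl fun ℓ _ => ?_
    rw [← Real.rpow_intCast, Real.rpow_def_of_pos (hy' ℓ), mul_comm]
  have hev : galeFun B μ =ᶠ[nhds y]
      fun y => Real.exp (∑ ℓ, (μ ℓ : ℝ) * Real.log (galeLin B ℓ y)) :=
    Filter.eventuallyEq_of_mem ((isOpen_galeInterval B).mem_nhds hy) fun y' hy' => (heq hy').symm
  have h := hexp.congr_of_eventuallyEq hev
  have e : Real.exp (∑ ℓ, (μ ℓ : ℝ) * Real.log (galeLin B ℓ y)) = galeFun B μ y := heq hy
  rw [e] at h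
  exact h

variable {w : Fin (n + 2) → Fin n → ℤ} {C : Matrix (Fin n) (Fin (n + 2)) ℝ}

/-- **(4.6): `∑_ℓ λ_ℓ B_{ℓ,1}/p_ℓ = ∑_r λ̄_r B_{ᾱ_r,1}/p_{ᾱ_r}` on `Δ_P`** ("`ℓ ∈ K_r` if and only if
… `P_ℓ = γ_{ℓr} P_{ᾱ_r}` … we can rewrite `G(y) = Σ_{r∈[k], λ̄_r≠0} λ̄_r B_{ᾱ_r,1}/p_{ᾱ_r}(y)`",
p0011:L77 – p0012:L6); proportional rows give equal quotients `B_{ℓ,1}/p_ℓ = B_{ᾱ_r,1}/p_{ᾱ_r}`.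
[cite: BihanDickenstein2017, §4.2 eq. (4.6)] -/
theorem sum_affRel_mul_div_eq_linComb (hrk : C.rank = n) (hcone : PosConeCond C)
    {K : Finset (Fin (n + 2))} (hK : IsMaxMinorSet C K) (α : Equiv.Perm (Fin (n + 2)))
    {B : Matrix (Fin (n + 2)) (Fin 2) ℝ} (hBd : IsGaleDual C B) {y : ℝ} (hy : y ∈ galeInterval B) :
    ∑ ℓ, (affRel w ℓ : ℝ) * (B ℓ 1 / galeLin B ℓ y) =
      linComb (fun r : Fin K.card => (lambdaBar w C K α r : ℝ) * B (restrictOrdering α K r) 1)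
        (fun r y => 1 / galeLin B (restrictOrdering α K r) y) y := by
  have hC := span_cols_erase_eq_top C hrk hcone
  rw [sum_eq_sum_minorClass C hC hK α]
  unfold linComb
  refine Finset.sum_congr rfl fun r _ => ?_
  have key : ∀ ℓ ∈ minorClass C K α r, B ℓ 1 / galeLin B ℓ y =
      B (restrictOrdering α K r) 1 / galeLin B (restrictOrdering α K r) y := by
    intro ℓ hℓ
    have hdet := (mem_minorClass_iff_galeDet_eq_zero C hrk hBd K α r ℓ).mp hℓ
    unfold galeDet at hdet
    rw [div_eq_div_iff (hy ℓ).ne' (hy _).ne']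
    unfold galeLin
    linear_combination hdet
  calc ∑ ℓ ∈ minorClass C K α r, (affRel w ℓ : ℝ) * (B ℓ 1 / galeLin B ℓ y)
      = ∑ ℓ ∈ minorClass C K α r, (affRel w ℓ : ℝ) *
          (B (restrictOrdering α K r) 1 / galeLin B (restrictOrdering α K r) y) :=
        Finset.sum_congr rfl fun ℓ hℓ => by rw [key ℓ hℓ]
    _ = (lambdaBar w C K α r : ℝ) * B (restrictOrdering α K r) 1 *
          (1 / galeLin B (restrictOrdering α K r) y) := by
        rw [← Finset.sum_mul, lambdaBar, Int.cast_sum]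
        ring

end Deriv

/-! ### (2.15): the bound `1 + sgnvar` for each normalized pair `(ᾱ_q, ᾱ_j)` -/

section Fifteen

variable {n : ℕ} {w : Fin (n + 2) → Fin n → ℤ} {C : Matrix (Fin n) (Fin (n + 2)) ℝ}

/-- **Rolle + Prop. 4.3** (p0011:L65 – p0012:L12): "By Rolle's theorem we get that `n_𝒜(C) ≤ N + 1`
where `N` is the number of roots of the derivative `g'` of `g` in `Δ_P` counted with
multiplicities", `g' = g · G` with `G = ∑_r λ̄_r B_{ᾱ_r,1} · (1/p_{ᾱ_r})`, and by Prop. 4.3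
`N ≤ sgnvar(λ̄_0 B_{ᾱ_0,1}, …, λ̄_{k−1} B_{ᾱ_{k−1},1})` (when this coefficient sequence is nonzero).
[cite: BihanDickenstein2017, §4.2 (proof of Thm. 2.9)] -/
theorem rootCountMult_galeFun_sub_one_le (hrk : C.rank = n) (hcone : PosConeCond C)
    {α : Equiv.Perm (Fin (n + 2))} (hα : IsOrdering C α) {K : Finset (Fin (n + 2))}
    (hK : IsMaxMinorSet C K) {B : Matrix (Fin (n + 2)) (Fin 2) ℝ} (hBd : IsGaleDual C B)
    (hne : (galeInterval B).Nonempty)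
    (hc : (fun r : Fin K.card => (lambdaBar w C K α r : ℝ) * B (restrictOrdering α K r) 1) ≠ 0) :
    rootCountMult (fun y => galeFun B (affRel w) y - 1) (galeInterval B) ≤
      signVar (List.ofFn fun r : Fin K.card =>
        (lambdaBar w C K α r : ℝ) * B (restrictOrdering α K r) 1) + 1 := by
  set c : Fin K.card → ℝ := fun r => (lambdaBar w C K α r : ℝ) * B (restrictOrdering α K r) 1
    with hc_def
  set h : Fin K.card → ℝ → ℝ := fun r y => 1 / galeLin B (restrictOrdering α K r) y with hh
  have hDesc := BD2017_prop_4_3_holds n C hrk hcone α hα K hK B hBd hne c hc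
  set G : ℝ → ℝ := fun y => galeFun B (affRel w) y - 1 with hG
  have hGan : AnalyticOnNhd ℝ G (galeInterval B) := fun y hy =>
    (analyticOnNhd_galeFun B _ y hy).sub analyticAt_const
  have hEq : Set.EqOn (deriv G) (fun y => galeFun B (affRel w) y * linComb c h y)
      (galeInterval B) := by
    intro y hy
    have h1 : HasDerivAt G
        (galeFun B (affRel w) y * ∑ ℓ, (affRel w ℓ : ℝ) * (B ℓ 1 / galeLin B ℓ y)) y :=
      (hasDerivAt_galeFun B (affRel w) hy).sub_const 1
    simp only
    rw [h1.deriv, sum_affRel_mul_div_eq_linComb hrk hcone hK α hBd hy]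
  obtain ⟨hset1, hcount1⟩ := rootCountMult_congr_of_eqOn (isOpen_galeInterval B) hEq
  obtain ⟨hset2, hcount2⟩ := rootCountMult_mul_left_eq (f := linComb c h)
    (g := galeFun B (affRel w)) (Δ := galeInterval B)
    (analyticOnNhd_linComb c h fun j => analyticOnNhd_one_div_galeLin B _)
    (analyticOnNhd_galeFun B _) (fun y hy => (galeFun_pos B _ hy).ne')
  have hfin : {y | y ∈ galeInterval B ∧ deriv G y = 0}.Finite := by
    rw [hset1, hset2]
    exact hDesc.1
  have hRolle := finite_zeros_and_rootCountMult_le_deriv_add_one (isOpen_galeInterval B)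
    (ordConnected_galeInterval B).isPreconnected hGan hfin
  calc rootCountMult G (galeInterval B)
      ≤ rootCountMult (deriv G) (galeInterval B) + 1 := hRolle.2
    _ = rootCountMult (linComb c h) (galeInterval B) + 1 := by rw [hcount1, hcount2]
    _ ≤ signVar (List.ofFn c) + 1 := Nat.add_le_add_right hDesc.2 1

/-- If `n_𝒜(C)` is finite and positive, two of the class sums `λ̄_r` are nonzero (not all vanish
by `BD17.posSolutions_infinite_iff`, and `∑_r λ̄_r = 0`); in particular `k ≥ 2`.
[cite: BihanDickenstein2017, Prop. 2.13 (proof)] -/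
theorem exists_two_lambdaBar_ne_zero (hrk : RankCond w C) (hcone : PosConeCond C)
    (hcirc : IsCircuit w) (hne : (posSolutions w C).Nonempty) {K : Finset (Fin (n + 2))}
    (hK : IsMaxMinorSet C K) (α : Equiv.Perm (Fin (n + 2))) (hfin : (posSolutions w C).Finite) :
    ∃ r₁ r₂ : Fin K.card, r₁ ≠ r₂ ∧ lambdaBar w C K α r₁ ≠ 0 ∧ lambdaBar w C K α r₂ ≠ 0 := by
  classical
  have hnot : ¬ ∀ r : Fin K.card, lambdaBar w C K α r = 0 := fun h =>
    ((posSolutions_infinite_iff w C hrk hcirc hne hK α).mpr h) hfin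
  push Not at hnot
  obtain ⟨r₁, hr₁⟩ := hnot
  have hsum := sum_lambdaBar_eq_zero w C (span_cols_erase_eq_top C hrk.2 hcone) hK α
  by_contra hcon
  push Not at hcon
  have hz : ∀ r, r ≠ r₁ → lambdaBar w C K α r = 0 := fun r hr => hcon r₁ r (Ne.symm hr) hr₁
  rw [Finset.sum_eq_single r₁ (fun r _ hr => hz r hr) (fun h => absurd (Finset.mem_univ _) h)]
    at hsum
  exact hr₁ hsum

/-- **BD 2017, Thm. 2.9 (2.15)**: `n_𝒜(C) ≤ sgnvar(s_α)` for any ordering `α` and any maximal `K`,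
when `n_𝒜(C)` is finite. [cite: BihanDickenstein2017, Thm. 2.9 eq. (2.15)] -/
theorem numPosSols_le_signVar_sAlpha (hrk : RankCond w C) (hcone : PosConeCond C)
    (hcirc : IsCircuit w) {α : Equiv.Perm (Fin (n + 2))} (hα : IsOrdering C α)
    {K : Finset (Fin (n + 2))} (hK : IsMaxMinorSet C K) (hfin : (posSolutions w C).Finite) :
    numPosSols w C ≤ signVar (sAlpha w C K α) := by
  classical
  rcases (posSolutions w C).eq_empty_or_nonempty with h0 | hne
  · simp [numPosSols, h0]
  obtain ⟨r₁, r₂, h12, hr₁, hr₂⟩ := exists_two_lambdaBar_ne_zero hrk hcone hcirc hne hK α hfin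
  have hC := span_cols_erase_eq_top C hrk.2 hcone
  have hsum := sum_lambdaBar_eq_zero w C hC hK α
  -- `sgnvar(s_α) ≠ 0`: a one-signed sequence summing to `0` vanishes
  have hsv : signVar (sAlpha w C K α) ≠ 0 := by
    intro h
    have hmem : ∀ r, (lambdaBar w C K α r : ℝ) ∈ sAlpha w C K α := fun r => by
      simp [sAlpha, List.mem_ofFn]
    rcases forall_nonneg_or_forall_nonpos_of_signVar_eq_zero _ h with hpos | hneg
    · have hall : ∀ r ∈ (Finset.univ : Finset (Fin K.card)), 0 ≤ lambdaBar w C K α r :=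
        fun r _ => by exact_mod_cast hpos _ (hmem r)
      exact hr₁ ((Finset.sum_eq_zero_iff_of_nonneg hall).mp hsum r₁ (Finset.mem_univ _))
    · have hall : ∀ r ∈ (Finset.univ : Finset (Fin K.card)), lambdaBar w C K α r ≤ 0 :=
        fun r _ => by exact_mod_cast hneg _ (hmem r)
      exact hr₁ ((Finset.sum_eq_zero_iff_of_nonpos hall).mp hsum r₁ (Finset.mem_univ _))
  obtain ⟨q₀, hq₀, hEq⟩ := (BD2017_lem_4_4_holds _ hsv).2
  have hq₀' : q₀ < K.card := by rwa [length_sAlpha] at hq₀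
  set q : Fin K.card := ⟨q₀, hq₀'⟩ with hq
  obtain ⟨j, hqj⟩ : ∃ j : Fin K.card, q ≠ j := by
    by_cases h : q = r₁
    · exact ⟨r₂, h ▸ h12⟩
    · exact ⟨r₁, h⟩
  have hab : restrictOrdering α K q ≠ restrictOrdering α K j :=
    fun h => hqj (restrictOrdering_injective α K h)
  have hmin : coeffMinor C (restrictOrdering α K q) (restrictOrdering α K j) ≠ 0 :=
    hK.1 _ (restrictOrdering_mem α K q) _ (restrictOrdering_mem α K j) hab
  obtain ⟨B, hB⟩ := exists_isNormalizedGaleBasis C hrk.2 hab hmin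
  have hG := galePoly_ne_zero_of_finite hrk hcirc hab hmin hB hcone hfin
  rw [numPosSols_eq_rootCountMult_galeFun hrk hcirc hab hmin hB hG]
  have hBd := hB.isGaleDual hrk.2
  have hΔne := galeInterval_nonempty hB hrk.2 hcone
  -- the sign data of the ordering for the normalized basis: `P_{ᾱ_q} = (1, 0)`
  obtain ⟨ε, hε, hord⟩ := hα B hBd
  have hε0 : ε ≠ 0 := by rcases hε with rfl | rfl <;> norm_num
  have hβ : ∀ r, galeDet B (restrictOrdering α K q) (restrictOrdering α K r) =
      B (restrictOrdering α K r) 1 := fun r => by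
    simp [galeDet, hB.left_fst, hB.left_snd]
  have hβ' : ∀ r, galeDet B (restrictOrdering α K r) (restrictOrdering α K q) =
      -B (restrictOrdering α K r) 1 := fun r => by
    simp [galeDet, hB.left_fst, hB.left_snd]
  have hne_r : ∀ r, r ≠ q → B (restrictOrdering α K r) 1 ≠ 0 := by
    intro r hr h0
    have h1 : restrictOrdering α K r ∈ minorClass C K α q :=
      (mem_minorClass_iff_galeDet_eq_zero C hrk.2 hBd K α q _).mpr (by rw [hβ r, h0])
    have h2 : restrictOrdering α K r ∈ minorClass C K α r :=
      (mem_minorClass_iff_galeDet_eq_zero C hrk.2 hBd K α r _).mpr (by simp [galeDet]; ring)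
    exact Finset.disjoint_left.mp (disjoint_minorClass C hC hK.1 α (Ne.symm hr)) h1 h2
  have hτ : StrictMono fun t : Fin K.card =>
      (K.map α.symm.toEmbedding).orderEmbOfFin (Finset.card_map _) t :=
    fun _ _ h => (OrderEmbedding.strictMono _) h
  have hlt : ∀ r, r < q → ε * B (restrictOrdering α K r) 1 < 0 := by
    intro r hr
    have h1 : 0 ≤ ε * galeDet B (restrictOrdering α K r) (restrictOrdering α K q) :=
      hord _ _ (hτ hr)
    rw [hβ' r, mul_neg] at h1
    exact lt_of_le_of_ne (by linarith) (mul_ne_zero hε0 (hne_r r hr.ne))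
  have hgt : ∀ r, q < r → 0 < ε * B (restrictOrdering α K r) 1 := by
    intro r hr
    have h1 : 0 ≤ ε * galeDet B (restrictOrdering α K q) (restrictOrdering α K r) :=
      hord _ _ (hτ hr)
    rw [hβ r] at h1
    exact lt_of_le_of_ne h1 (Ne.symm (mul_ne_zero hε0 (hne_r r hr.ne')))
  -- the coefficient sequence `(λ̄_r B_{ᾱ_r,1})_r` is nonzero
  have hc : (fun r : Fin K.card =>
      (lambdaBar w C K α r : ℝ) * B (restrictOrdering α K r) 1) ≠ 0 := by
    intro h0
    have hz : ∀ r, r ≠ q → lambdaBar w C K α r = 0 := fun r hr => by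
      have := congr_fun h0 r
      simp only [Pi.zero_apply, mul_eq_zero] at this
      rcases this with h | h
      · exact_mod_cast h
      · exact absurd h (hne_r r hr)
    by_cases h1 : r₁ = q
    · exact hr₂ (hz r₂ fun h => h12 (h1.trans h.symm))
    · exact hr₁ (hz r₁ h1)
  have hbound := rootCountMult_galeFun_sub_one_le (w := w) hrk.2 hcone hα hK hBd hΔne hc
  have hsign := signVar_ofFn_mul_eq (fun r => (lambdaBar w C K α r : ℝ))
    (fun r => B (restrictOrdering α K r) 1) q hε hB.left_snd hlt hgt
  have hsα : sAlpha w C K α = List.ofFn fun r => (lambdaBar w C K α r : ℝ) := rfl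
  calc rootCountMult (fun y => galeFun B (affRel w) y - 1) (galeInterval B)
      ≤ signVar (List.ofFn fun r : Fin K.card =>
          (lambdaBar w C K α r : ℝ) * B (restrictOrdering α K r) 1) + 1 := hbound
    _ = signVar (((sAlpha w C K α).take q₀).map (fun c => -c) ++
          (sAlpha w C K α).drop (q₀ + 1)) + 1 := by rw [hsign, hsα]
    _ = signVar (sAlpha w C K α) := by rw [hEq]; ring

end Fifteen

/-! ### (2.16): the volume bound via the coprime relation `λ̃` -/

section Sixteen

variable {n : ℕ}

/-- `p_ℓ` has degree `≤ 1`. [cite: BihanDickenstein2017, §4.1 eq. (4.1)] -/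
theorem natDegree_linPoly_le (B : Matrix (Fin (n + 2)) (Fin 2) ℝ) (ℓ : Fin (n + 2)) :
    (linPoly B ℓ).natDegree ≤ 1 := by
  unfold linPoly
  compute_degree!

/-- `deg ∏_{s} p_ℓ^{e_ℓ} ≤ ∑_{s} e_ℓ`. [cite: BihanDickenstein2017, §4.2 (proof of Thm. 2.9)] -/
theorem natDegree_prod_linPoly_pow_le (B : Matrix (Fin (n + 2)) (Fin 2) ℝ)
    (s : Finset (Fin (n + 2))) (e : Fin (n + 2) → ℕ) :
    (∏ ℓ ∈ s, linPoly B ℓ ^ e ℓ).natDegree ≤ ∑ ℓ ∈ s, e ℓ := by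
  refine (Polynomial.natDegree_prod_le _ _).trans (Finset.sum_le_sum fun ℓ _ => ?_)
  refine (Polynomial.natDegree_pow_le).trans ?_
  have := natDegree_linPoly_le B ℓ
  calc e ℓ * (linPoly B ℓ).natDegree ≤ e ℓ * 1 := Nat.mul_le_mul_left _ this
    _ = e ℓ := mul_one _

/-- `∑_{μ>0} μ_ℓ = ∑_{μ<0} (−μ_ℓ)` for an integer vector with `∑ μ_ℓ = 0` (eq. (2.4)).
[cite: BihanDickenstein2017, §2.1 eq. (2.4)] -/
theorem sum_filter_pos_eq_sum_filter_neg_int (μ : Fin (n + 2) → ℤ) (h0 : ∑ ℓ, μ ℓ = 0) :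
    ∑ ℓ ∈ Finset.univ.filter (fun ℓ => 0 < μ ℓ), μ ℓ =
      ∑ ℓ ∈ Finset.univ.filter (fun ℓ => μ ℓ < 0), -μ ℓ := by
  rw [Finset.sum_filter, Finset.sum_filter, ← sub_eq_zero, ← Finset.sum_sub_distrib]
  have hterm : ∀ ℓ ∈ (Finset.univ : Finset (Fin (n + 2))),
      ((if 0 < μ ℓ then μ ℓ else 0) - if μ ℓ < 0 then -μ ℓ else 0) = μ ℓ := by
    intro ℓ _
    by_cases h1 : 0 < μ ℓ
    · have h2 : ¬ μ ℓ < 0 := by omega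
      simp [h1, h2]
    · by_cases h2 : μ ℓ < 0
      · simp [h1, h2]
      · have h3 : μ ℓ = 0 := by omega
        simp [h3]
  rw [Finset.sum_congr rfl hterm]
  exact h0

/-- **"the degree of the polynomial `∏_{μ>0} p^{μ} − ∏_{μ<0} p^{−μ}` … is at most `∑_{μ_ℓ>0} μ_ℓ`"**
(p0012:L28–30), for any integer relation with `∑ μ_ℓ = 0`.
[cite: BihanDickenstein2017, §4.2 (proof of Thm. 2.9)] -/
theorem natDegree_galePoly_le (B : Matrix (Fin (n + 2)) (Fin 2) ℝ) (μ : Fin (n + 2) → ℤ)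
    (h0 : ∑ ℓ, μ ℓ = 0) :
    ((galePoly B μ).natDegree : ℤ) ≤ ∑ ℓ ∈ Finset.univ.filter (fun ℓ => 0 < μ ℓ), μ ℓ := by
  have hA := natDegree_prod_linPoly_pow_le B (Finset.univ.filter (fun ℓ => 0 < μ ℓ))
    (fun ℓ => (μ ℓ).toNat)
  have hD := natDegree_prod_linPoly_pow_le B (Finset.univ.filter (fun ℓ => μ ℓ < 0))
    (fun ℓ => (-μ ℓ).toNat)
  have hcastA : ((∑ ℓ ∈ Finset.univ.filter (fun ℓ => 0 < μ ℓ), (μ ℓ).toNat : ℕ) : ℤ) =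
      ∑ ℓ ∈ Finset.univ.filter (fun ℓ => 0 < μ ℓ), μ ℓ := by
    rw [Nat.cast_sum]
    refine Finset.sum_congr rfl fun ℓ hℓ => ?_
    exact Int.toNat_of_nonneg (le_of_lt (Finset.mem_filter.mp hℓ).2)
  have hcastD : ((∑ ℓ ∈ Finset.univ.filter (fun ℓ => μ ℓ < 0), (-μ ℓ).toNat : ℕ) : ℤ) =
      ∑ ℓ ∈ Finset.univ.filter (fun ℓ => μ ℓ < 0), -μ ℓ := by
    rw [Nat.cast_sum]
    refine Finset.sum_congr rfl fun ℓ hℓ => ?_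
    exact Int.toNat_of_nonneg (by have := (Finset.mem_filter.mp hℓ).2; omega)
  have hsub := Polynomial.natDegree_sub_le
    (∏ ℓ ∈ Finset.univ.filter (fun ℓ => 0 < μ ℓ), linPoly B ℓ ^ (μ ℓ).toNat)
    (∏ ℓ ∈ Finset.univ.filter (fun ℓ => μ ℓ < 0), linPoly B ℓ ^ (-μ ℓ).toNat)
  unfold galePoly
  rcases le_max_iff.mp hsub with h | h
  · calc ((_ : ℕ) : ℤ) ≤ ((∑ ℓ ∈ Finset.univ.filter (fun ℓ => 0 < μ ℓ), (μ ℓ).toNat : ℕ) : ℤ) := by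
          exact_mod_cast h.trans hA
      _ = _ := hcastA
  · calc ((_ : ℕ) : ℤ) ≤ ((∑ ℓ ∈ Finset.univ.filter (fun ℓ => μ ℓ < 0), (-μ ℓ).toNat : ℕ) : ℤ) := by
          exact_mod_cast h.trans hD
      _ = ∑ ℓ ∈ Finset.univ.filter (fun ℓ => μ ℓ < 0), -μ ℓ := hcastD
      _ = _ := (sum_filter_pos_eq_sum_filter_neg_int μ h0).symm

/-- **`G_μ` divides `G_{kμ}`** (`k ≥ 1`): `∏ p^{(kμ)⁺} − ∏ p^{(kμ)⁻} = A^k − D^k` is divisible by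
`A − D`; used to pass `g ≢ 1` from `λ = I λ̃` to `λ̃`. [cite: BihanDickenstein2017, §2.1 eq. (2.2)] -/
theorem galePoly_dvd_galePoly_nsmul (B : Matrix (Fin (n + 2)) (Fin 2) ℝ) (μ : Fin (n + 2) → ℤ)
    {k : ℕ} (hk : 0 < k) : galePoly B μ ∣ galePoly B ((k : ℤ) • μ) := by
  have hk' : (0 : ℤ) < k := by exact_mod_cast hk
  have hf1 : Finset.univ.filter (fun ℓ => 0 < ((k : ℤ) • μ) ℓ) =
      Finset.univ.filter (fun ℓ => 0 < μ ℓ) := by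
    ext ℓ
    simp only [Finset.mem_filter, Finset.mem_univ, true_and, Pi.smul_apply, smul_eq_mul]
    exact mul_pos_iff_of_pos_left hk'
  have hf2 : Finset.univ.filter (fun ℓ => ((k : ℤ) • μ) ℓ < 0) =
      Finset.univ.filter (fun ℓ => μ ℓ < 0) := by
    ext ℓ
    simp only [Finset.mem_filter, Finset.mem_univ, true_and, Pi.smul_apply, smul_eq_mul]
    constructor
    · intro h
      by_contra h'
      push Not at h'
      nlinarith
    · intro h
      nlinarith
  have hA : ∏ ℓ ∈ Finset.univ.filter (fun ℓ => 0 < ((k : ℤ) • μ) ℓ),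
      linPoly B ℓ ^ (((k : ℤ) • μ) ℓ).toNat =
      (∏ ℓ ∈ Finset.univ.filter (fun ℓ => 0 < μ ℓ), linPoly B ℓ ^ (μ ℓ).toNat) ^ k := by
    rw [hf1, ← Finset.prod_pow]
    refine Finset.prod_congr rfl fun ℓ hℓ => ?_
    have hμ0 : 0 ≤ μ ℓ := le_of_lt (Finset.mem_filter.mp hℓ).2
    rw [← pow_mul, mul_comm]
    congr 1
    simp only [Pi.smul_apply, smul_eq_mul]
    rw [show (k : ℤ) * μ ℓ = ((k * (μ ℓ).toNat : ℕ) : ℤ) by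
      rw [Nat.cast_mul, Int.toNat_of_nonneg hμ0], Int.toNat_natCast]
  have hD : ∏ ℓ ∈ Finset.univ.filter (fun ℓ => ((k : ℤ) • μ) ℓ < 0),
      linPoly B ℓ ^ (-((k : ℤ) • μ) ℓ).toNat =
      (∏ ℓ ∈ Finset.univ.filter (fun ℓ => μ ℓ < 0), linPoly B ℓ ^ (-μ ℓ).toNat) ^ k := by
    rw [hf2, ← Finset.prod_pow]
    refine Finset.prod_congr rfl fun ℓ hℓ => ?_
    have hμ0 : 0 ≤ -μ ℓ := by have := (Finset.mem_filter.mp hℓ).2; omega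
    rw [← pow_mul, mul_comm]
    congr 1
    simp only [Pi.smul_apply, smul_eq_mul]
    rw [show -((k : ℤ) * μ ℓ) = ((k * (-μ ℓ).toNat : ℕ) : ℤ) by
      rw [Nat.cast_mul, Int.toNat_of_nonneg hμ0]; ring, Int.toNat_natCast]
  unfold galePoly
  rw [hA, hD]
  exact sub_dvd_pow_sub_pow _ _ k

variable {w : Fin (n + 2) → Fin n → ℤ} {C : Matrix (Fin n) (Fin (n + 2)) ℝ}

/-- `I ≠ 0` for a circuit (all `λ_j ≠ 0`). [cite: BihanDickenstein2017, §2.1 eq. (2.2)] -/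
theorem relIndex_ne_zero (hcirc : IsCircuit w) : relIndex w ≠ 0 := by
  intro h
  rw [relIndex, Finset.gcd_eq_zero_iff] at h
  exact hcirc 0 (h 0 (Finset.mem_univ _))

/-- `I ≥ 0` (the normalized gcd). [cite: BihanDickenstein2017, §2.1 eq. (2.2)] -/
theorem relIndex_nonneg (w : Fin (n + 2) → Fin n → ℤ) : 0 ≤ relIndex w := by
  rw [relIndex, ← Finset.normalize_gcd, ← Int.abs_eq_normalize]
  exact abs_nonneg _

/-- `λ_ℓ = I · λ̃_ℓ` (2.2). [cite: BihanDickenstein2017, §2.1 eq. (2.2)] -/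
theorem affRel_eq_relIndex_mul (w : Fin (n + 2) → Fin n → ℤ) (ℓ : Fin (n + 2)) :
    affRel w ℓ = relIndex w * affRelCoprime w ℓ := by
  unfold affRelCoprime
  exact (Int.mul_ediv_cancel' (Finset.gcd_dvd (Finset.mem_univ ℓ))).symm

/-- `λ = I • λ̃` as vectors. [cite: BihanDickenstein2017, §2.1 eq. (2.2)] -/
theorem affRel_eq_smul_affRelCoprime (w : Fin (n + 2) → Fin n → ℤ) :
    affRel w = relIndex w • affRelCoprime w := by
  funext ℓ
  simp only [Pi.smul_apply, smul_eq_mul]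
  exact affRel_eq_relIndex_mul w ℓ

/-- For a circuit, `λ_ℓ > 0 ⟺ λ̃_ℓ > 0` (`I > 0`). [cite: BihanDickenstein2017, §2.1 eq. (2.2)] -/
theorem affRel_pos_iff (hcirc : IsCircuit w) (ℓ : Fin (n + 2)) :
    0 < affRel w ℓ ↔ 0 < affRelCoprime w ℓ := by
  have hI : 0 < relIndex w := lt_of_le_of_ne (relIndex_nonneg w) (Ne.symm (relIndex_ne_zero hcirc))
  rw [affRel_eq_relIndex_mul]
  exact mul_pos_iff_of_pos_left hI

/-- `λ̃ ∈ ker A`. [cite: BihanDickenstein2017, §2.1 eq. (2.2)] -/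
theorem expMatrix_mulVec_affRelCoprime (hcirc : IsCircuit w) :
    (expMatrix w).mulVec (affRelCoprime w) = 0 := by
  have h := expMatrix_mulVec_affRel w
  rw [affRel_eq_smul_affRelCoprime, Matrix.mulVec_smul] at h
  exact (smul_eq_zero.mp h).resolve_left (relIndex_ne_zero hcirc)

/-- `∑_ℓ λ̃_ℓ = 0`. [cite: BihanDickenstein2017, §2.1 eq. (2.1)–(2.2)] -/
theorem sum_affRelCoprime_eq_zero (hcirc : IsCircuit w) : ∑ ℓ, affRelCoprime w ℓ = 0 := by
  rw [← expMatrix_mulVec_zero w (affRelCoprime w), expMatrix_mulVec_affRelCoprime hcirc]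
  rfl

/-- `vol_{ℤ𝒜}(𝒜) = ∑_{λ̃_ℓ>0} λ̃_ℓ` (2.4) (the filter on `λ > 0` equals the filter on `λ̃ > 0`).
[cite: BihanDickenstein2017, §2.1 eq. (2.4)] -/
theorem normVolume_eq_sum_filter (hcirc : IsCircuit w) :
    normVolume w = ∑ ℓ ∈ Finset.univ.filter (fun ℓ => 0 < affRelCoprime w ℓ), affRelCoprime w ℓ := by
  unfold normVolume
  congr 1
  ext ℓ
  simp [affRel_pos_iff hcirc]

/-- `vol_{ℤ𝒜}(𝒜) ≥ 0`. [cite: BihanDickenstein2017, §2.1 eq. (2.3)] -/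
theorem normVolume_nonneg (hcirc : IsCircuit w) : 0 ≤ normVolume w := by
  rw [normVolume_eq_sum_filter hcirc]
  exact Finset.sum_nonneg fun ℓ hℓ => le_of_lt (Finset.mem_filter.mp hℓ).2

/-- `g ≢ 1` for `λ` implies `g ≢ 1` for `λ̃` (`G_{λ̃} ∣ G_λ`).
[cite: BihanDickenstein2017, §4.2 (proof of Thm. 2.9)] -/
theorem galePoly_affRelCoprime_ne_zero (hcirc : IsCircuit w) {B : Matrix (Fin (n + 2)) (Fin 2) ℝ}
    (hG : galePoly B (affRel w) ≠ 0) : galePoly B (affRelCoprime w) ≠ 0 := by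
  intro h0
  apply hG
  have hI : 0 < relIndex w := lt_of_le_of_ne (relIndex_nonneg w) (Ne.symm (relIndex_ne_zero hcirc))
  have hk : 0 < (relIndex w).toNat := by omega
  have : affRel w = ((relIndex w).toNat : ℤ) • affRelCoprime w := by
    rw [Int.toNat_of_nonneg hI.le]
    exact affRel_eq_smul_affRelCoprime w
  rw [this]
  obtain ⟨R, hR⟩ := galePoly_dvd_galePoly_nsmul B (affRelCoprime w) hk
  rw [hR, h0, zero_mul]

/-- **BD 2017, Thm. 2.9 (2.16)**: `n_𝒜(C) ≤ vol_{ℤ𝒜}(𝒜)` when `n_𝒜(C)` is finite ("the number of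
roots of `g − 1` counted with multiplicity is at most the degree of `∏_{λ̃>0} p^{λ̃} − ∏_{λ̃<0} p^{−λ̃}`
…, which is at most `∑_{λ̃_ℓ>0} λ̃_ℓ`, itself equal to the normalized volume `vol_{ℤ𝒜}(𝒜)` by
(2.4)", p0012:L26–31). [cite: BihanDickenstein2017, Thm. 2.9 eq. (2.16)] -/
theorem numPosSols_le_normVolume (hrk : RankCond w C) (hcone : PosConeCond C)
    (hcirc : IsCircuit w) (hfin : (posSolutions w C).Finite) :
    (numPosSols w C : ℤ) ≤ normVolume w := by
  classical
  rcases (posSolutions w C).eq_empty_or_nonempty with h0 | hne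
  · simp only [numPosSols, h0, finsum_mem_empty, Nat.cast_zero]
    exact normVolume_nonneg hcirc
  obtain ⟨K, hK⟩ := exists_isMaxMinorSet C
  obtain ⟨r₁, r₂, h12, -, -⟩ :=
    exists_two_lambdaBar_ne_zero hrk hcone hcirc hne hK (Equiv.refl _) hfin
  have hab : restrictOrdering (Equiv.refl _) K r₁ ≠ restrictOrdering (Equiv.refl _) K r₂ :=
    fun h => h12 (restrictOrdering_injective _ K h)
  have hmin : coeffMinor C (restrictOrdering (Equiv.refl _) K r₁)
      (restrictOrdering (Equiv.refl _) K r₂) ≠ 0 :=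
    hK.1 _ (restrictOrdering_mem _ K r₁) _ (restrictOrdering_mem _ K r₂) hab
  obtain ⟨B, hB⟩ := exists_isNormalizedGaleBasis C hrk.2 hab hmin
  have hG := galePoly_ne_zero_of_finite hrk hcirc hab hmin hB hcone hfin
  have hμA : (expMatrix w).mulVec (affRelCoprime w) = 0 := expMatrix_mulVec_affRelCoprime hcirc
  have hμb : affRelCoprime w (restrictOrdering (Equiv.refl _) K r₂) ≠ 0 := fun h =>
    hcirc _ (by rw [affRel_eq_relIndex_mul, h, mul_zero])
  have hGμ : galePoly B (affRelCoprime w) ≠ 0 := galePoly_affRelCoprime_ne_zero hcirc hG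
  -- the change of variable `Y : x ↦ x^{w_b − w_a}` (kept opaque)
  obtain ⟨Y, hY⟩ : ∃ Y : (Fin n → ℝ) → ℝ, ∀ x, Y x =
      monomial (w (restrictOrdering (Equiv.refl _) K r₂) - w (restrictOrdering (Equiv.refl _) K r₁)) x :=
    ⟨_, fun _ => rfl⟩
  -- `n_𝒜(C) = ∑_{x} mult_{Y x} G_μ ≤ #roots(G_μ) ≤ deg G_μ`
  have h1 : numPosSols w C =
      ∑ x ∈ hfin.toFinset, (galePoly B (affRelCoprime w)).rootMultiplicity (Y x) := by
    unfold numPosSols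
    rw [finsum_mem_eq_finite_toFinset_sum _ hfin]
    refine Finset.sum_congr rfl fun x hx => ?_
    rw [hY x]
    exact solMultiplicity_eq_rootMultiplicity w C hrk hcirc hab hmin hB (affRelCoprime w) hμA hμb
      (hfin.mem_toFinset.mp hx) hGμ
  have hinj : ∀ x ∈ hfin.toFinset, ∀ x' ∈ hfin.toFinset, Y x = Y x' → x = x' := by
    intro x hx x' hx' h
    rw [hY, hY] at h
    exact injOn_monomial_sub hrk hcirc hab hmin hB (hfin.mem_toFinset.mp hx)
      (hfin.mem_toFinset.mp hx') h
  have h2 : ∑ y ∈ hfin.toFinset.image Y, (galePoly B (affRelCoprime w)).rootMultiplicity y =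
      ∑ x ∈ hfin.toFinset, (galePoly B (affRelCoprime w)).rootMultiplicity (Y x) := by
    rw [Finset.sum_image]
    exact hinj
  have hsub : hfin.toFinset.image Y ⊆ (galePoly B (affRelCoprime w)).roots.toFinset := by
    intro y hy
    obtain ⟨x, hx, rfl⟩ := Finset.mem_image.mp hy
    have hdata : GaleLocalData w C _ _ B x := ⟨hrk, hcirc, hab, hmin, hB, hfin.mem_toFinset.mp hx⟩
    rw [Multiset.mem_toFinset, Polynomial.mem_roots hGμ, Polynomial.IsRoot.def, hY x]
    exact hdata.eval_galePoly_yPt (affRelCoprime w) hμA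
  have h3 : ∑ y ∈ hfin.toFinset.image Y, (galePoly B (affRelCoprime w)).rootMultiplicity y ≤
      ∑ y ∈ (galePoly B (affRelCoprime w)).roots.toFinset,
        (galePoly B (affRelCoprime w)).rootMultiplicity y :=
    Finset.sum_le_sum_of_subset_of_nonneg hsub fun _ _ _ => Nat.zero_le _
  have h4 : ∑ y ∈ (galePoly B (affRelCoprime w)).roots.toFinset,
      (galePoly B (affRelCoprime w)).rootMultiplicity y =
      Multiset.card (galePoly B (affRelCoprime w)).roots := by
    rw [← Multiset.toFinset_sum_count_eq]
    exact Finset.sum_congr rfl fun y _ => (Polynomial.count_roots _).symm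
  have h5 : ∑ y ∈ (galePoly B (affRelCoprime w)).roots.toFinset,
      (galePoly B (affRelCoprime w)).rootMultiplicity y ≤
      (galePoly B (affRelCoprime w)).natDegree :=
    h4.le.trans (Polynomial.card_roots' _)
  have hdeg := natDegree_galePoly_le B (affRelCoprime w) (sum_affRelCoprime_eq_zero hcirc)
  rw [← normVolume_eq_sum_filter hcirc] at hdeg
  have h6 : numPosSols w C ≤ (galePoly B (affRelCoprime w)).natDegree := by
    rw [h1, ← h2]
    exact h3.trans h5
  calc (numPosSols w C : ℤ) ≤ ((galePoly B (affRelCoprime w)).natDegree : ℤ) := by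
        exact_mod_cast h6
    _ ≤ normVolume w := hdeg

end Sixteen

end BD17

/-! ### The discharges -/

open BD17 in
/-- **BD 2017, Thm. 2.9 — DISCHARGED** (`theorem BD2017_thm_2_9_holds : BD2017_thm_2_9`): for a
circuit `𝒜` and a coefficient matrix `C` satisfying (1.4)–(1.5), any ordering `α` and maximal `K`,
if `n_𝒜(C)` is finite then `n_𝒜(C) ≤ sgnvar(s_α)` (2.15) and `n_𝒜(C) ≤ vol_{ℤ𝒜}(𝒜)` (2.16).
[cite: BihanDickenstein2017, Thm. 2.9] -/
theorem BD2017_thm_2_9_holds : BD2017_thm_2_9 :=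
  fun _n _w _C hrk hcone hcirc _α hα _K hK hfin =>
    ⟨numPosSols_le_signVar_sAlpha hrk hcone hcirc hα hK hfin,
      numPosSols_le_normVolume hrk hcone hcirc hfin⟩

/-- **BD 2017, Cor. 3.1 — DISCHARGED** (via `BD2017_cor_3_1_of_thm_2_9'`).
[cite: BihanDickenstein2017, Cor. 3.1] -/
theorem BD2017_cor_3_1_holds : BD2017_cor_3_1 :=
  BD2017_cor_3_1_of_thm_2_9' BD2017_thm_2_9_holds

/-- **BD 2017, Thm. 3.3 — DISCHARGED** (via `BD2017_thm_3_3_of_thm_2_9`).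
[cite: BihanDickenstein2017, Thm. 3.3] -/
theorem BD2017_thm_3_3_holds : BD2017_thm_3_3 :=
  BD2017_thm_3_3_of_thm_2_9 BD2017_thm_2_9_holds

/-- **BD 2017, Cor. 3.4 — DISCHARGED** (via `BD2017_cor_3_4_of_thm_2_9`).
[cite: BihanDickenstein2017, Cor. 3.4] -/
theorem BD2017_cor_3_4_holds : BD2017_cor_3_4 :=
  BD2017_cor_3_4_of_thm_2_9 BD2017_thm_2_9_holds

end Literature.Computability.AlgebraicComplexity
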